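import Summits.AnomalousDissipation.AnomalousDissipation.Theses.TaylorCertificates
import Summits.AnomalousDissipation.AnomalousDissipation.Theorems.TaylorCertificatesSteadyClassicalBridgeDirect
import Summits.AnomalousDissipation.AnomalousDissipation.Theorems.TaylorCertificatesSteadyStatesLoudBoundedStubResidualTransfer
import Summits.AnomalousDissipation.AnomalousDissipation.Theorems.TaylorCertificatesSteadyStatesLoudBoundedStubCompactnessSplit
import Summits.AnomalousDissipation.AnomalousDissipation.Theorems.TaylorCertificatesSteadyStatesLoudBoundedStubTruncationResidual
import Summits.AnomalousDissipation.AnomalousDissipation.Theorems.TaylorCertificatesSteadyStatesLoudBoundedStubDodgerAssembly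
import Summits.AnomalousDissipation.AnomalousDissipation.Theorems.TaylorCertificatePair.Negative.Modes
import Literature.Analysis.FunctionSpaces.TorusLinearisedNSEnergy
import Literature.Analysis.FunctionSpaces.TorusSobolevSpaceProofs
import HarnessLib.Audit

/-!
# Typed statements behind `STRATEGY-CENSUS.md` v3 (crux stmt-AnomalousDissipation-13038, crux-strategist seat s1, 2026-08-17)

Companion of `CensusSketch.lean` (v2, seat s0; its decls `Body`, `FatSteadyBranch`, `F123FatSteadyBranch`,
`FatBranchConjecture`, `SteadyFloorAllBoundedSome`, … are referred to, not redefined, except where v3 sharpens them).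
Everything here elaborates; the only `Prop`-valued *claims* without proof are marked "(typed, provable now)" —
all theorems are sorry-free.

* §0  vocabulary (`IsCruxSteady`, `Body`, `crux_iff_exists_body`).
* §T  TRANSFER of the blow-down/rigidity method from the regular-ray case to ALL fat branches:
      `IsFatSeq`, `HasFatSkeleton`, `FatBlowDown` (typed, provable now: a fat sequence of steady states blows down,
      after multiplication by `ν`, to a nonzero `H¹` UNFORCED steady Euler state `U` with `‖∇U‖² ≤ (U,f)`), and
      `EveryForceHasFatSkeleton` (typed, provable now: every nonzero admissible `f` has such a `U` — a small multiple of
      one of its own Fourier modes, which is a shear flow). Together: the obstruction-theoretic route to a CEILING is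
      void for every force (the necessary condition is always met).
* §S  STRENGTHEN: `NoFatSkeleton f` (the ceiling-by-rigidity S⁺; false for every `f ≠ 0` by §T) and the one-line
      reduction `noFatSeq_of_noFatSkeleton`.
* §D  DECOMPOSITION: `SteadyCeilingAt`, `SteadyFloorInBallAt`, `crux_of_ceiling_floorInBall` (PROVED) — the best honest
      split has the FLOOR leaf weakened to the `E`-ball (exactly what the live line's floor machinery proves) and the
      CEILING leaf isolated; `ceiling_of_body` (PROVED): every split inherits a ceiling leaf.
* §N  NEGATION: `F123SteadyStatesAbove (E)` — the MINIMAL kill of the live ceiling stub's steady shadow (any steady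
      states of energy `> E` at arbitrarily small `ν`, fat or not) with `not_ceiling_of_statesAbove` (PROVED).
* §R  REPAIR v3: `BoundedSteadyBranchAt`, `SteadyFloorInBallBoundedSome` (floor for all steady states IN THE BALL
      `∫|u|² ≤ E` + SOME steady state in the ball, each small `ν`), `repair_of_crux` (PROVED: weaker than the crux, via
      Temam existence + regularity + the landed classical bridge), `anomalousDissipation_of_floorInBall_boundedSome`
      (PROVED: it decides the summit), and the RESTATED LINE AT `f₁₂₃`: `repairV3_of_f123_stubs` /
      `anomalousDissipation_of_f123_stubs` (PROVED modulo exactly two hypotheses: the LIVE registered floor stub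
      `stub_f123NoOnsagerDodgerLevel3` VERBATIM and ONE new ∃-stub `BoundedSteadyBranchAt f₁₂₃ 2 ν₂`).
-/

noncomputable section

set_option linter.dupNamespace false

namespace Summit.AnomalousDissipation.AnomalousDissipation.Cruxes.SteadyStatesLoudBounded.StrategyCensusV3

open MeasureTheory Filter Topology UnitAddTorus Matrix
open scoped InnerProductSpace ENNReal
open Literature.Analysis.FunctionSpaces Literature.Analysis.FluidPDE
open Summit.AnomalousDissipation.AnomalousDissipation.Theses.TaylorCertificates
open Summit.AnomalousDissipation.AnomalousDissipation.Theorems.TaylorCertificatePair.Negative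

/-- Local notation: real vector fields on `T³`. -/
local notation "Vec3" => ((UnitAddTorus (Fin 3)) → (EuclideanSpace ℝ (Fin 3)))
/-- Local notation: the torus. -/
local notation "𝕋³" => (UnitAddTorus (Fin 3))
/-- Local notation: `L²(T³; ℝ³)`. -/
local notation "L2" => (Lp (EuclideanSpace ℝ (Fin 3)) 2 (volume : Measure (UnitAddTorus (Fin 3))))
/-- Local notation: the energy space `H`. -/
local notation "H3" => (Torus.energySpace (Fin 3))
/-- Frequencies `e₃, 2e₁, 3e₂` of the detuned cyclic force (verbatim the live skeleton's). -/
local notation "K₁₂₃" => (![![0, 0, 1], ![2, 0, 0], ![0, 3, 0]] : Fin 3 → (Fin 3 → ℤ))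
/-- Amplitudes `-i e₁, -i e₂, -i e₃` (verbatim the live skeleton's). -/
local notation "Z₁₂₃" => (![(WithLp.toLp 2 ![-Complex.I, 0, 0] : EuclideanSpace ℂ (Fin 3)), (WithLp.toLp 2 ![0, -Complex.I, 0] : EuclideanSpace ℂ (Fin 3)), (WithLp.toLp 2 ![0, 0, -Complex.I] : EuclideanSpace ℂ (Fin 3))] : Fin 3 → EuclideanSpace ℂ (Fin 3))
/-- `f₁₂₃ = (sin 2πx₃, sin 4πx₁, sin 6πx₂)` as the tree's mode sum (verbatim the live skeleton's). -/
local notation "f₁₂₃" => (∑ mm, Torus.realTrigPoly {K₁₂₃ mm} (fun _ => Z₁₂₃ mm))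

/-! ## §0 Vocabulary -/

/-- The crux's steady weak form of `NS_ν(f)` at a smooth `u` (verbatim the hypothesis block of the route decl). -/
def IsCruxSteady (ν : ℝ) (f u : Vec3) : Prop :=
  ∀ w : Vec3, Torus.IsSmooth w → Torus.IsDivFree w → Torus.HasZeroMean w →
    ∫ x, inner ℝ (ν • Torus.laplacian u x - Torus.convect u u x + f x) (w x) = 0

/-- The crux body at a pinned force (as in v2). -/
def Body (f : Vec3) : Prop :=
  ∃ (ε₀ E ν₀ : ℝ), 0 < ε₀ ∧ 0 < ν₀ ∧ ∀ ν : ℝ, 0 < ν → ν < ν₀ → ∀ u : Vec3, Torus.IsSmooth u → Torus.IsDivFree u →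
    Torus.HasZeroMean u → IsCruxSteady ν f u → ε₀ ≤ ν * Torus.gradNormSq u ∧ ∫ x, ‖u x‖ ^ 2 ≤ E

theorem crux_iff_exists_body :
    SteadyStatesLoudBounded ↔ ∃ f : Vec3, Torus.IsSmooth f ∧ Torus.IsDivFree f ∧ Torus.HasZeroMean f ∧ Body f := Iff.rfl

/-! ## §T Transfer — blow-down of fat branches; every force passes the necessary condition -/

/-- A **FAT sequence** of steady states of `f`: viscosities `ν_n → 0⁺`, smooth admissible classical steady states
`u_n` of `NS_{ν_n}(f)`, and `ν_n² ∫|u_n|² ≥ c > 0` (the laminar energy scale). -/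
def IsFatSeq (f : Vec3) (ν : ℕ → ℝ) (u : ℕ → Vec3) : Prop :=
  (∀ n, 0 < ν n) ∧ Tendsto ν atTop (𝓝 0) ∧
    (∀ n, Torus.IsSmooth (u n) ∧ Torus.IsDivFree (u n) ∧ Torus.HasZeroMean (u n) ∧ IsCruxSteady (ν n) f (u n)) ∧
    ∃ c : ℝ, 0 < c ∧ ∀ n, c ≤ (ν n) ^ 2 * ∫ x, ‖u n x‖ ^ 2

/-- `f` admits a **FAT SKELETON**: a nonzero finite-enstrophy UNFORCED steady Euler state `U ∈ V` (the tree's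
`Torus.IsSteadyWeakSolution` at viscosity `0` and force `0`) with `‖∇U‖² ≤ (U, f)` — in particular `(f, U) > 0`. -/
def HasFatSkeleton (f : Vec3) : Prop :=
  ∃ U : H3, (U : L2) ∈ Torus.energySpaceV (Fin 3) ∧ Torus.IsSteadyWeakSolution 0 (0 : Vec3) U ∧ U ≠ 0 ∧
    (Torus.eGradNormSq ((U : L2) : Vec3)).toReal ≤ Torus.pairing (U : L2) f

/-- **T7 — BLOW-DOWN OF FAT SEQUENCES (typed, provable now, size M).** If `u_n` is a fat sequence of steady states of a
smooth `f`, then `v_n := ν_n u_n` satisfies `‖∇v_n‖² = (f, v_n) ≤ ‖f‖ ‖v_n‖ ≤ ‖f‖²/(4π²)` (energy identity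
`ν‖∇u‖² = (f,u)` multiplied by `ν_n`, and `dissipation_le`), so `(v_n)` is bounded in `H¹`, precompact in `L²`
(Rellich on `T³`), and every `L²`-limit `U` has `‖U‖² ≥ c > 0`, lies in `V`, solves the UNFORCED steady Euler
equations weakly (`(v_n·∇)v_n + ∇q_n = ν_n²(f + Δv_n)` tested against smooth `w`: the right side is
`ν_n²[(f,w) + (v_n, Δw)] → 0`, the quadratic term passes to the limit by strong `L²` convergence), and
`‖∇U‖² ≤ liminf ‖∇v_n‖² = lim (f, v_n) = (f, U)`. So a fat branch of `f` can only exist on an `H¹` skeleton on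
which the force does positive work dominating the enstrophy — the 3-D content of Disproof §9 read backwards. -/
def FatBlowDown : Prop :=
  ∀ f : Vec3, Torus.IsSmooth f → ∀ (ν : ℕ → ℝ) (u : ℕ → Vec3), IsFatSeq f ν u → HasFatSkeleton f

/-- **EVERY NONZERO ADMISSIBLE FORCE HAS A FAT SKELETON (typed, provable now, size S–M).** Pick a frequency `k` with
`f̂(k) ≠ 0`; the real divergence-free Fourier mode `M_k` of `f` at `±k` depends on `x` only through `k·x` and is
orthogonal to `k`, hence is a smooth steady Euler flow (`(M·∇)M = (M·k)M' = 0`, Disproof `isSteady_laminar_of_euler`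
/ CensusSketch `IsPhaseOnly`); `(f, M_k) = ‖M_k‖² > 0` and `‖∇(sM_k)‖² = s²·4π²|k|²‖M_k‖² ≤ s‖M_k‖² = (f, sM_k)` for
`0 < s ≤ 1/(4π²|k|²)`. CONSEQUENCE (§T7 of the census): the necessary condition for fat branches delivered by the
blow-down is met by EVERY force, so no ceiling can be certified by first-order rigidity; the regular-ray lemma
`F123NoRegularRayBranch` (v2) was the strongest statement of that kind and it does not exclude deformed fat states. -/
def EveryForceHasFatSkeleton : Prop :=
  ∀ f : Vec3, Torus.IsSmooth f → Torus.IsDivFree f → Torus.HasZeroMean f → (∃ x, f x ≠ 0) → HasFatSkeleton f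

/-! ## §S Strengthen — the ceiling-by-rigidity S⁺ and why it buys nothing -/

/-- **S5: `NoFatSkeleton f`** — the strengthening of the CEILING half that the blow-down method could actually
prove things from (`noFatSeq_of_noFatSkeleton`): no `H¹` unforced steady Euler state does work `≥` its enstrophy.
By `EveryForceHasFatSkeleton` it is FALSE for every nonzero admissible `f` (and `f = 0` has no floor): the added
rigidity is vacuous. -/
def NoFatSkeleton (f : Vec3) : Prop := ¬ HasFatSkeleton f

/-- The one-line reduction the S⁺ would feed (PROVED, pure logic): blow-down + no skeleton ⇒ no fat sequence. -/
theorem noFatSeq_of_noFatSkeleton (hBD : FatBlowDown) {f : Vec3} (hf : Torus.IsSmooth f) (h : NoFatSkeleton f) :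
    ∀ (ν : ℕ → ℝ) (u : ℕ → Vec3), ¬ IsFatSeq f ν u :=
  fun ν u hfat => h (hBD f hf ν u hfat)

/-- And the S⁺ is void for every admissible nonzero force (PROVED from the typed §T fact). -/
theorem not_noFatSkeleton (hE : EveryForceHasFatSkeleton) {f : Vec3} (hfs : Torus.IsSmooth f) (hfd : Torus.IsDivFree f)
    (hfz : Torus.HasZeroMean f) (hne : ∃ x, f x ≠ 0) : ¬ NoFatSkeleton f :=
  fun h => h (hE f hfs hfd hfz hne)

/-! ## §D Decomposition — the best honest split: FLOOR weakened to the ball, CEILING isolated -/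

/-- CEILING conjunct of the crux at a pinned `f` below `ν₁` at level `E`. -/
def SteadyCeilingAt (f : Vec3) (E ν₁ : ℝ) : Prop :=
  ∀ ν : ℝ, 0 < ν → ν < ν₁ → ∀ u : Vec3, Torus.IsSmooth u → Torus.IsDivFree u → Torus.HasZeroMean u →
    IsCruxSteady ν f u → ∫ x, ‖u x‖ ^ 2 ≤ E

/-- FLOOR IN THE BALL: below `ν₀` every steady state of `f` with `∫|u|² ≤ E` is `ε₀`-loud (exactly the shape the
landed residual transfer `stub_residualTransfer` proves from Lamb rigidity at level `E`). -/
def SteadyFloorInBallAt (f : Vec3) (E ε₀ ν₀ : ℝ) : Prop :=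
  ∀ ν : ℝ, 0 < ν → ν < ν₀ → ∀ u : Vec3, Torus.IsSmooth u → Torus.IsDivFree u → Torus.HasZeroMean u →
    IsCruxSteady ν f u → ∫ x, ‖u x‖ ^ 2 ≤ E → ε₀ ≤ ν * Torus.gradNormSq u

/-- **D4 — the split closes the crux (PROVED).** `SteadyCeilingAt f E ν₁ → SteadyFloorInBallAt f E ε₀ ν₀ →
SteadyStatesLoudBounded` for admissible `f`: sharper than v2's `crux_of_pinned_split` (the floor leaf is only asked
IN the ball the ceiling provides), and it exhibits the CEILING as the leaf carrying the crux's (numerically dead)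
content. Not filed as a route split: its rank-1 leaf is believed false at every screened force. -/
theorem crux_of_ceiling_floorInBall {f : Vec3} (hf : Torus.IsSmooth f ∧ Torus.IsDivFree f ∧ Torus.HasZeroMean f)
    {E ε₀ ν₀ ν₁ : ℝ} (hε₀ : 0 < ε₀) (hν₀ : 0 < ν₀) (hν₁ : 0 < ν₁)
    (hC : SteadyCeilingAt f E ν₁) (hF : SteadyFloorInBallAt f E ε₀ ν₀) : SteadyStatesLoudBounded := by
  refine ⟨f, hf.1, hf.2.1, hf.2.2, ε₀, E, min ν₀ ν₁, hε₀, lt_min hν₀ hν₁, ?_⟩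
  intro ν hν hνlt u hus hud huz hst
  have hE : ∫ x, ‖u x‖ ^ 2 ≤ E := hC ν hν (lt_of_lt_of_le hνlt (min_le_right _ _)) u hus hud huz hst
  exact ⟨hF ν hν (lt_of_lt_of_le hνlt (min_le_left _ _)) u hus hud huz hst hE, hE⟩

/-- **Every decomposition inherits a ceiling leaf (PROVED, projection):** `Body f` contains `SteadyCeilingAt f E ν₀`
verbatim, so any `Sub₁ ∧ … ∧ Sub_k → Body f` proves a ceiling at `f`. -/
theorem ceiling_of_body {f : Vec3} (h : Body f) : ∃ E ν₁ : ℝ, 0 < ν₁ ∧ SteadyCeilingAt f E ν₁ := by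
  obtain ⟨ε₀, E, ν₀, _, hν₀, hB⟩ := h
  exact ⟨E, ν₀, hν₀, fun ν hν hνlt u hus hud huz hst => (hB ν hν hνlt u hus hud huz hst).2⟩

/-- … and a floor-in-the-ball leaf (PROVED, projection). -/
theorem floorInBall_of_body {f : Vec3} (h : Body f) : ∃ E ε₀ ν₀ : ℝ, 0 < ε₀ ∧ 0 < ν₀ ∧ SteadyFloorInBallAt f E ε₀ ν₀ := by
  obtain ⟨ε₀, E, ν₀, hε₀, hν₀, hB⟩ := h
  exact ⟨E, ε₀, ν₀, hε₀, hν₀, fun ν hν hνlt u hus hud huz hst _ => (hB ν hν hνlt u hus hud huz hst).1⟩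

/-! ## §N Negation — the minimal kill of a ceiling at level `E` -/

/-- `f` has steady states of energy `> E` at arbitrarily small viscosity (fat, warm or `O(1)` — anything above the
level). For `f₁₂₃` and `E = 2` this is the exact steady shadow of `¬ stub_f123EnsembleCeiling2` (Dirac masses at
steady states are stationary statistical solutions, `DiracAtoms.norm_sq_le_of_ceiling` in the live skeleton); the
fat gravest-ray branch (v2 `F123FatSteadyBranch`, kit j018963; reproduced at K = 8 by the lead's j020770, E = 9.56 at
ν = 0.005) is one witness family, but ANY family above energy `2` accumulating at `ν = 0` suffices. -/
def SteadyStatesAbove (f : Vec3) (E : ℝ) : Prop :=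
  ∀ ν₀ : ℝ, 0 < ν₀ → ∃ ν : ℝ, 0 < ν ∧ ν < ν₀ ∧ ∃ u : Vec3, Torus.IsSmooth u ∧ Torus.IsDivFree u ∧
    Torus.HasZeroMean u ∧ IsCruxSteady ν f u ∧ E < ∫ x, ‖u x‖ ^ 2

/-- The instance the disprover needs for the LIVE ceiling stub (steady shadow): steady states of `f₁₂₃` above energy `2`
at arbitrarily small `ν`. Numerically TRUE (fat branch, `∫|u|² = 9.6 → 84` for `ν = 0.005 → 0.0019`). -/
def F123SteadyStatesAbove2 : Prop := SteadyStatesAbove f₁₂₃ 2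

/-- **States above the level kill the ceiling at that level (PROVED).** -/
theorem not_ceiling_of_statesAbove {f : Vec3} {E : ℝ} (h : SteadyStatesAbove f E) :
    ¬ ∃ ν₁ : ℝ, 0 < ν₁ ∧ SteadyCeilingAt f E ν₁ := by
  rintro ⟨ν₁, hν₁, hC⟩
  obtain ⟨ν, hν, hνlt, u, hus, hud, huz, hst, hE⟩ := h ν₁ hν₁
  have := hC ν hν hνlt u hus hud huz hst
  linarith

/-- … hence kill the crux body at that force for that level and every smaller one (PROVED; with `E` ranging over all
levels this is v2's `not_body_of_fatSteadyBranch` without the fatness). -/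
theorem not_body_of_statesAbove_all {f : Vec3} (h : ∀ E : ℝ, SteadyStatesAbove f E) : ¬ Body f := by
  intro hB
  obtain ⟨E, ν₁, hν₁, hC⟩ := ceiling_of_body hB
  exact not_ceiling_of_statesAbove (h E) ⟨ν₁, hν₁, hC⟩

/-! ## §R Repair v3 — FLOOR IN THE BALL for all steady states + SOME steady state in the ball (typed; glue PROVED) -/

/-- SOME bounded steady state at each small viscosity: below `ν₂`, `NS_ν(f)` has a smooth admissible classical steady
state with `∫|u|² ≤ E`. (Numerical candidate at `f₁₂₃`, `E = 2`: the Stokes-connected primary branch, `∫|u|² ≤ 1.13`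
down to `ν = 0.0021` at K ≤ 24, lead c1 kit j019660/j020781.) A sequential weakening (`∃ ν_j → 0⁺` instead of all
`ν < ν₂`) decides the summit by the same proof. -/
def BoundedSteadyBranchAt (f : Vec3) (E ν₂ : ℝ) : Prop :=
  ∀ ν : ℝ, 0 < ν → ν < ν₂ → ∃ u : Vec3, Torus.IsSmooth u ∧ Torus.IsDivFree u ∧ Torus.HasZeroMean u ∧
    IsCruxSteady ν f u ∧ ∫ x, ‖u x‖ ^ 2 ≤ E

/-- **REPAIRED DECIDING HYPOTHESIS v3 (recommended restatement of #3).** Some admissible `f` and `ε₀, E, ν₀ > 0` such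
that for every `ν ∈ (0, ν₀)`: (i) every smooth admissible classical steady state of `NS_ν(f)` WITH `∫|u|² ≤ E` is
`ε₀`-loud (FLOOR IN THE BALL — the certificate-flavoured ∀-clause, exactly what Lamb rigidity at level `E` + the landed
residual transfer prove), and (ii) SOME smooth admissible classical steady state has `∫|u|² ≤ E`. Weaker than the crux
(`repair_of_crux`) and than v2's `SteadyFloorAllBoundedSome` (floor only in the ball: fat, warm and above-level `O(1)`
states are nobody's business any more); untouched by every fat branch; decides the summit
(`anomalousDissipation_of_floorInBall_boundedSome`). -/
def SteadyFloorInBallBoundedSome : Prop :=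
  ∃ f : Vec3, Torus.IsSmooth f ∧ Torus.IsDivFree f ∧ Torus.HasZeroMean f ∧
    ∃ (ε₀ E ν₀ : ℝ), 0 < ε₀ ∧ 0 < ν₀ ∧ ∀ ν : ℝ, 0 < ν → ν < ν₀ →
      (∀ u : Vec3, Torus.IsSmooth u → Torus.IsDivFree u → Torus.HasZeroMean u → IsCruxSteady ν f u →
          ∫ x, ‖u x‖ ^ 2 ≤ E → ε₀ ≤ ν * Torus.gradNormSq u) ∧
      (∃ u : Vec3, Torus.IsSmooth u ∧ Torus.IsDivFree u ∧ Torus.HasZeroMean u ∧ IsCruxSteady ν f u ∧ ∫ x, ‖u x‖ ^ 2 ≤ E)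

/-- The pinned pieces give the repaired statement (PROVED, pure logic) — the shape of the restated item's line. -/
theorem repair_of_pinned {f : Vec3} (hf : Torus.IsSmooth f ∧ Torus.IsDivFree f ∧ Torus.HasZeroMean f)
    {E ε₀ ν₀ ν₂ : ℝ} (hε₀ : 0 < ε₀) (hν₀ : 0 < ν₀) (hν₂ : 0 < ν₂)
    (hF : SteadyFloorInBallAt f E ε₀ ν₀) (hB : BoundedSteadyBranchAt f E ν₂) : SteadyFloorInBallBoundedSome := by
  refine ⟨f, hf.1, hf.2.1, hf.2.2, ε₀, E, min ν₀ ν₂, hε₀, lt_min hν₀ hν₂, fun ν hν hνlt => ⟨?_, ?_⟩⟩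
  · exact fun u hus hud huz hst hE => hF ν hν (lt_of_lt_of_le hνlt (min_le_left _ _)) u hus hud huz hst hE
  · exact hB ν hν (lt_of_lt_of_le hνlt (min_le_right _ _))

/-- **The repaired statement is WEAKER than the crux (PROVED).** The crux's floor gives (i) (forgetting that it even
holds outside the ball); Temam's steady weak solution at viscosity `ν` (`Temam1979_exists_steadyWeakSolution_holds` +
`_energy_eq_holds`), its smooth representative (`_smooth_holds`) and the landed classical bridge
(`steadyClassicalBridge_direct_proof`, item 14884) give a classical steady state, bounded by the crux's ceiling: (ii). -/
theorem repair_of_crux : SteadyStatesLoudBounded → SteadyFloorInBallBoundedSome := by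
  rintro ⟨f, hfs, hfd, hfz, ε₀, E, ν₀, hε₀, hν₀, hall⟩
  refine ⟨f, hfs, hfd, hfz, ε₀, E, ν₀, hε₀, hν₀, fun ν hν hνlt => ⟨?_, ?_⟩⟩
  · exact fun u hus hud huz hst _ => (hall ν hν hνlt u hus hud huz hst).1
  · have hf2 : MemLp f 2 (volume : Measure 𝕋³) := hfs.memLp 2
    obtain ⟨U, hV, hU, -⟩ :=
      Torus.exists_isSteadyWeakSolution_energy_eq Torus.Temam1979_exists_steadyWeakSolution_holds
        Torus.Temam1979_steadyWeakSolution_energy_eq_holds (d := Fin 3) (by simp) hν hf2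
    obtain ⟨v, hv, hUv⟩ := Torus.Temam1979_steadyWeakSolution_smooth_holds (d := Fin 3) (by simp) hν hfs hV hU
    obtain ⟨hvd, hvz, hvst⟩ :=
      Summit.AnomalousDissipation.AnomalousDissipation.Theorems.steadyClassicalBridge_direct_proof ν f v U hfs hU hv hUv
    exact ⟨v, hv, hvd, hvz, hvst, (hall ν hν hνlt v hv hvd hvz hvst).2⟩

/-- **Energy identity at a classical steady state**: `ν‖∇u‖² = (u, f)` (as in v2). -/
theorem energy_identity_classical {ν : ℝ} {f u : Vec3} (hf : Torus.IsSmooth f) (hu : Torus.IsSmooth u) (hdiv : Torus.IsDivFree u)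
    (hmean : Torus.HasZeroMean u) (hst : IsCruxSteady ν f u) :
    ν * Torus.gradNormSq u = ∫ x, inner ℝ (u x) (f x) := by
  have h := hst u hu hdiv hmean
  have i1 : Integrable (fun x => inner ℝ (ν • Torus.laplacian u x) (u x)) volume := by
    have := ((hu.laplacian.inner hu).integrable).const_mul ν
    refine this.congr (ae_of_all _ fun x => ?_)
    simp [inner_smul_left]
  have i2 : Integrable (fun x => inner ℝ (Torus.convect u u x) (u x)) volume := ((hu.convect hu).inner hu).integrable
  have i3 : Integrable (fun x => inner ℝ (f x) (u x)) volume := (hf.inner hu).integrable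
  have hlap : ∫ x, inner ℝ (ν • Torus.laplacian u x) (u x) = -(ν * Torus.gradNormSq u) := by
    have : ∫ x, inner ℝ (ν • Torus.laplacian u x) (u x) = ν * ∫ x, inner ℝ (Torus.laplacian u x) (u x) := by
      rw [← integral_const_mul]
      refine integral_congr_ae (ae_of_all _ fun x => ?_)
      simp [inner_smul_left]
    rw [this, Torus.integral_inner_laplacian_self_eq_neg_gradNormSq_of_isSmooth hu]
    ring
  have htri : ∫ x, inner ℝ (Torus.convect u u x) (u x) = 0 := by
    have h1 := Torus.integral_inner_convect_eq_neg hu hdiv hu hu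
    have h2 : ∫ x, inner ℝ (u x) (Torus.convect u u x) = ∫ x, inner ℝ (Torus.convect u u x) (u x) :=
      integral_congr_ae (ae_of_all _ fun x => real_inner_comm _ _)
    rw [h2] at h1
    linarith
  have hfu : ∫ x, inner ℝ (f x) (u x) = ∫ x, inner ℝ (u x) (f x) :=
    integral_congr_ae (ae_of_all _ fun x => real_inner_comm _ _)
  have key : ∫ x, inner ℝ (ν • Torus.laplacian u x - Torus.convect u u x + f x) (u x) =
      (∫ x, inner ℝ (ν • Torus.laplacian u x) (u x)) - (∫ x, inner ℝ (Torus.convect u u x) (u x)) + ∫ x, inner ℝ (f x) (u x) := by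
    simp_rw [inner_add_left, inner_sub_left]
    rw [integral_add ?_ i3, integral_sub i1 i2]
    exact i1.sub i2
  rw [key, hlap, htri, hfu] at h
  linarith

/-- Bridge, classical ⇒ `H`-weak (as in v2 / the live skeleton). -/
theorem exists_steadyState_of_classical {ν : ℝ} {f u : Vec3}
    (hf : Torus.IsSmooth f) (hu : Torus.IsSmooth u) (hdiv : Torus.IsDivFree u) (hmean : Torus.HasZeroMean u)
    (hsteady : IsCruxSteady ν f u) :
    ∃ U : H3, ((U : L2) : Vec3) =ᵐ[volume] u ∧ (U : L2) ∈ Torus.energySpaceV (Fin 3) ∧ Torus.IsSteadyWeakSolution ν f U := by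
  have hsol : (hu.memLp 2).toLp u ∈ Torus.smoothSolenoidal (Fin 3) := ⟨u, hu, hdiv, hmean, MemLp.coeFn_toLp _⟩
  refine ⟨⟨(hu.memLp 2).toLp u, Torus.smoothSolenoidal_subset_energySpace hsol⟩, (hu.memLp 2).coeFn_toLp,
    Torus.smoothSolenoidal_subset_energySpaceV_holds hsol, fun w hw hdw hzw => ?_⟩
  have hU : ((((⟨(hu.memLp 2).toLp u, Torus.smoothSolenoidal_subset_energySpace hsol⟩ : H3) : L2) : Vec3)) =ᵐ[volume] u :=
    (hu.memLp 2).coeFn_toLp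
  have h1 : (∫ x, inner ℝ ((((⟨(hu.memLp 2).toLp u, Torus.smoothSolenoidal_subset_energySpace hsol⟩ : H3) : L2) : Vec3) x)
        (Torus.laplacian w x)) = ∫ x, inner ℝ (u x) (Torus.laplacian w x) := by
    refine integral_congr_ae ?_
    filter_upwards [hU] with x hx
    rw [hx]
  have h2 : (∫ x, inner ℝ (Torus.fderiv w x ((((⟨(hu.memLp 2).toLp u, Torus.smoothSolenoidal_subset_energySpace hsol⟩ : H3) : L2) : Vec3) x))
        ((((⟨(hu.memLp 2).toLp u, Torus.smoothSolenoidal_subset_energySpace hsol⟩ : H3) : L2) : Vec3) x)) =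
        ∫ x, inner ℝ (Torus.fderiv w x (u x)) (u x) := by
    refine integral_congr_ae ?_
    filter_upwards [hU] with x hx
    rw [hx]
  unfold Torus.nsGeneratorPairing Torus.inertialPairing
  rw [h1, h2]
  have hlap : ∫ x, inner ℝ (u x) (Torus.laplacian w x) = ∫ x, inner ℝ (Torus.laplacian u x) (w x) :=
    (Torus.integral_inner_laplacian_comm hu hw).symm
  have hconv : ∫ x, inner ℝ (Torus.fderiv w x (u x)) (u x) = -∫ x, inner ℝ (Torus.convect u u x) (w x) := by
    change ∫ x, inner ℝ (Torus.convect u w x) (u x) = _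
    rw [Torus.integral_inner_convect_eq_neg hu hdiv hw hu]
    congr 1
    exact integral_congr_ae (ae_of_all _ fun x => real_inner_comm _ _)
  have i1 : Integrable (fun x => inner ℝ (ν • Torus.laplacian u x) (w x)) volume := by
    have := ((hu.laplacian.inner hw).integrable).const_mul ν
    refine this.congr (ae_of_all _ fun x => ?_)
    simp [inner_smul_left]
  have i2 : Integrable (fun x => inner ℝ (Torus.convect u u x) (w x)) volume := ((hu.convect hu).inner hw).integrable
  have i3 : Integrable (fun x => inner ℝ (f x) (w x)) volume := (hf.inner hw).integrable
  have key : ∫ x, inner ℝ (ν • Torus.laplacian u x - Torus.convect u u x + f x) (w x) =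
      (∫ x, inner ℝ (f x) (w x)) + ν * (∫ x, inner ℝ (u x) (Torus.laplacian w x)) +
        ∫ x, inner ℝ (Torus.fderiv w x (u x)) (u x) := by
    simp_rw [inner_add_left, inner_sub_left]
    rw [integral_add ?_ i3, integral_sub i1 i2, hlap, hconv]
    · have : ∫ x, inner ℝ (ν • Torus.laplacian u x) (w x) = ν * ∫ x, inner ℝ (Torus.laplacian u x) (w x) := by
        rw [← integral_const_mul]
        refine integral_congr_ae (ae_of_all _ fun x => ?_)
        simp [inner_smul_left]
      rw [this]
      ring
    · exact i1.sub i2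
  rw [← key]
  exact hsteady w hw hdw hzw

/-- **THE REPAIRED STATEMENT v3 DECIDES THE SUMMIT (PROVED): `SteadyFloorInBallBoundedSome → AnomalousDissipation`.**
Along `ν_j = ν₀/(j+2)` take the bounded classical steady state `u_j` of clause (ii); it is loud by clause (i) BECAUSE it
is in the ball; its `H`-state `U_j ∈ V` is a steady weak solution (bridge) with the energy equation
(`energy_identity_classical`), so the constant path is a global Leray–Hopf solution with `meanDissipation = ν_j‖∇u_j‖²
≥ ε₀` and `meanEnergy = ∫|u_j|² ≤ E` (MirrorVariety's landed `steadyWeakIsGlobalLerayHopf_proof`). -/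
theorem anomalousDissipation_of_floorInBall_boundedSome : SteadyFloorInBallBoundedSome → _root_.AnomalousDissipation := by
  intro hS
  obtain ⟨f, hfs, hfd, hfz, ε₀, E, ν₀, hε₀, hν₀, hall⟩ := hS
  have hL := Summit.AnomalousDissipation.AnomalousDissipation.Theorems.steadyWeakIsGlobalLerayHopf_proof
  have key : ∀ j : ℕ, ∃ U : H3,
      Torus.IsGlobalLerayHopf (ν₀ / ((j : ℝ) + 2)) (fun _ => f) ((U : L2) : Vec3) (fun _ => ((U : L2) : Vec3)) ∧
        ε₀ ≤ Literature.Analysis.FluidPDE.meanDissipation (ν₀ / ((j : ℝ) + 2)) (fun _ : ℝ => ((U : L2) : Vec3)) ∧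
          Literature.Analysis.FluidPDE.meanEnergy (fun _ : ℝ => ((U : L2) : Vec3)) ≤ E := by
    intro j
    have hj : (0 : ℝ) < (j : ℝ) + 2 := by positivity
    have hν : 0 < ν₀ / ((j : ℝ) + 2) := div_pos hν₀ hj
    have hνlt : ν₀ / ((j : ℝ) + 2) < ν₀ := by
      rw [div_lt_iff₀ hj]
      nlinarith
    obtain ⟨hfloor, u, hus, hud, huz, hust, hbdd⟩ := hall _ hν hνlt
    have hloud : ε₀ ≤ ν₀ / ((j : ℝ) + 2) * Torus.gradNormSq u := hfloor u hus hud huz hust hbdd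
    obtain ⟨U, hUu, hV, hUsteady⟩ := exists_steadyState_of_classical hfs hus hud huz hust
    have hEq : ν₀ / ((j : ℝ) + 2) * (Torus.eGradNormSq ((U : L2) : Vec3)).toReal = Torus.pairing (U : L2) f := by
      rw [Torus.eGradNormSq_congr_ae_field hUu, ← Torus.gradNormSq_eq_toReal_eGradNormSq_holds hus,
        energy_identity_classical hfs hus hud huz hust]
      unfold Torus.pairing
      refine integral_congr_ae ?_
      filter_upwards [hUu] with x hx
      rw [hx]
    obtain ⟨hLH, hmE, hmD⟩ := hL _ f U hν hfs hfz hV hUsteady hEq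
    refine ⟨U, hLH, ?_, ?_⟩
    · rw [hmD, Torus.eGradNormSq_congr_ae_field hUu, ← Torus.gradNormSq_eq_toReal_eGradNormSq_holds hus]
      exact hloud
    · rw [hmE]
      calc (∫ x, ‖((U : L2) : Vec3) x‖ ^ 2) = ∫ x, ‖u x‖ ^ 2 := by
              refine integral_congr_ae ?_
              filter_upwards [hUu] with x hx
              rw [hx]
        _ ≤ E := hbdd
  choose U hU using key
  refine ⟨f, hfs, hfd, hfz, fun j => ν₀ / ((j : ℝ) + 2), fun j => ((U j : L2) : Vec3), fun j _ => ((U j : L2) : Vec3),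
    fun j => div_pos hν₀ (by positivity), ?_, fun j => (hU j).1, ⟨E, fun j => (hU j).2.2⟩, ε₀, hε₀, fun j => (hU j).2.1⟩
  have h1 : Tendsto (fun j : ℕ => ((j : ℝ) + 2)⁻¹) atTop (𝓝 0) :=
    tendsto_inv_atTop_zero.comp (tendsto_atTop_add_const_right atTop (2 : ℝ) tendsto_natCast_atTop_atTop)
  have h2 : Tendsto (fun j : ℕ => ν₀ * ((j : ℝ) + 2)⁻¹) atTop (𝓝 (ν₀ * 0)) := h1.const_mul ν₀
  rw [mul_zero] at h2
  simpa [div_eq_mul_inv] using h2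

/-! ## §R′ The restated LINE at `f₁₂₃`: live floor stub S1′ VERBATIM + one new ∃-stub ⟹ repaired statement ⟹ summit -/

/-- `R` bounds the Euler/Lamb residual functional in the dual norm over the test class (live skeleton's vocabulary). -/
def IsResidualBound (f u : Vec3) (R : ℝ) : Prop :=
  ∀ w : Vec3, Torus.IsSmooth w → Torus.IsDivFree w → Torus.HasZeroMean w →
    |∫ x, inner ℝ (Torus.convect u u x - f x) (w x)| ≤ R * Real.sqrt (Torus.gradNormSq w)

/-- Lamb rigidity with a residual cap at level `E` (live skeleton's vocabulary). -/
def RigidAt (f : Vec3) (E c δ₀ : ℝ) : Prop :=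
  ∀ u : Vec3, Torus.IsSmooth u → Torus.IsDivFree u → Torus.HasZeroMean u → ∫ x, ‖u x‖ ^ 2 ≤ E →
    ∀ R : ℝ, 0 ≤ R → IsResidualBound f u R → R ≤ δ₀ → c ≤ R * Real.sqrt (Torus.gradNormSq u)

/-- Enemy (Q) excluded at level `E` (live skeleton's vocabulary). -/
def NoQuietEulerPointV (f : Vec3) (E : ℝ) : Prop :=
  ∀ u : H3, (u : L2) ∈ Torus.energySpaceV (Fin 3) → Torus.IsSteadyWeakSolution 0 f u → E < ‖u‖ ^ 2

/-- Enemy (D) excluded at level `E` (live skeleton's vocabulary). -/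
def NoOnsagerDodger (f : Vec3) (E : ℝ) : Prop :=
  ∀ (u : ℕ → Vec3) (R : ℕ → ℝ),
    (∀ n : ℕ, Torus.IsSmooth (u n) ∧ Torus.IsDivFree (u n) ∧ Torus.HasZeroMean (u n) ∧
        ∫ x, ‖u n x‖ ^ 2 ≤ E ∧ 0 ≤ R n ∧ IsResidualBound f (u n) (R n)) →
      Tendsto R atTop (𝓝 0) → Tendsto (fun n => R n * Real.sqrt (Torus.gradNormSq (u n))) atTop (𝓝 0) →
      ∃ B : ℝ, ∀ N : ℕ, ∃ n : ℕ, N ≤ n ∧ Torus.gradNormSq (u n) ≤ B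

/-- **The LIVE registered floor stub `stub_f123NoOnsagerDodgerLevel3`, VERBATIM as a Prop** (no dodgers of `f₁₂₃`
below energy `3`). Under the restatement it is consumed unchanged: the lead's work carries over entirely. -/
def StubF123NoOnsagerDodgerLevel3 : Prop :=
  ∀ (u : ℕ → UnitAddTorus (Fin 3) → EuclideanSpace ℝ (Fin 3)) (R : ℕ → ℝ),
    (∀ n : ℕ, Torus.IsSmooth (u n) ∧ Torus.IsDivFree (u n) ∧ Torus.HasZeroMean (u n) ∧
      ∫ x, ‖u n x‖ ^ 2 ≤ 3 ∧ 0 ≤ R n ∧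
      ∀ w : UnitAddTorus (Fin 3) → EuclideanSpace ℝ (Fin 3),
        Torus.IsSmooth w → Torus.IsDivFree w → Torus.HasZeroMean w →
        |∫ x, inner ℝ (Torus.convect (u n) (u n) x - (f₁₂₃) x) (w x)| ≤ R n * Real.sqrt (Torus.gradNormSq w)) →
    Tendsto R atTop (𝓝 0) →
    Tendsto (fun n => R n * Real.sqrt (Torus.gradNormSq (u n))) atTop (𝓝 0) →
    ∃ B : ℝ, ∀ N : ℕ, ∃ n : ℕ, N ≤ n ∧ Torus.gradNormSq (u n) ≤ B

/-- The three frequencies are nonzero. -/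
theorem f123_freq_ne_zero : ∀ m, K₁₂₃ m ≠ 0 := by decide

/-- The amplitudes are transversal: `f₁₂₃` is divergence free. -/
theorem f123_transversal : ∀ m, ((fun j => ((K₁₂₃ m) j : ℂ)) ⬝ᵥ (WithLp.ofLp (Z₁₂₃ m))) = 0 := by
  intro m
  fin_cases m <;>
    simp [dotProduct, Fin.sum_univ_three, Matrix.cons_val_zero, Matrix.cons_val_one, Matrix.cons_val_two,
      Matrix.head_cons, Matrix.tail_cons]

/-- `f₁₂₃` is smooth, divergence free and mean zero (as in the live skeleton). -/
theorem f123_smooth_divFree_zeroMean :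
    Torus.IsSmooth f₁₂₃ ∧ Torus.IsDivFree f₁₂₃ ∧ Torus.HasZeroMean f₁₂₃ :=
  ⟨isSmooth_modes _ _, isDivFree_modes _ _ f123_transversal, hasZeroMean_modes _ _ f123_freq_ne_zero⟩

/-- L2 folded: the landed residual transfer `stub_residualTransfer` (p85255). -/
theorem residualTransfer {ν E c δ₀ : ℝ} {f : Vec3} (hν : 0 < ν) (hδ₀ : 0 < δ₀) (hf : Torus.IsSmooth f)
    (hR : RigidAt f E c δ₀) {u : Vec3} (hus : Torus.IsSmooth u) (hud : Torus.IsDivFree u)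
    (huz : Torus.HasZeroMean u) (hst : IsCruxSteady ν f u) (hE : ∫ x, ‖u x‖ ^ 2 ≤ E) :
    min c (δ₀ ^ 2 / ν) ≤ ν * Torus.gradNormSq u :=
  _root_.Summit.AnomalousDissipation.AnomalousDissipation.Theorems.SteadyStatesLoudBounded.ResidualTransfer.stub_residualTransfer
    ν E c δ₀ f hν hδ₀ hf hR u hus hud huz hst hE

/-- L3 folded: the landed compactness split `stub_compactnessSplit` (p85561). -/
theorem rigidAt_of_noEnemies {f : Vec3} {E : ℝ} (hf : Torus.IsSmooth f) (hQ : NoQuietEulerPointV f E)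
    (hD : NoOnsagerDodger f E) : ∃ c δ₀ : ℝ, 0 < c ∧ 0 < δ₀ ∧ RigidAt f E c δ₀ :=
  _root_.Summit.AnomalousDissipation.AnomalousDissipation.Theorems.SteadyStatesLoudBounded.CompactnessSplit.stub_compactnessSplit
    f E hf hQ hD

/-- L4 folded: quiet `V`-points spawn dodgers one level up (`stub_truncationResidual` p85500 + `stub_dodgerAssembly` p89006). -/
theorem le_energy_of_quietPoint {f : Vec3} {E : ℝ} (hf : Torus.IsSmooth f) (hD : NoOnsagerDodger f E) (u : H3)
    (hV : (u : L2) ∈ Torus.energySpaceV (Fin 3)) (hsol : Torus.IsSteadyWeakSolution 0 f u) : E ≤ ‖u‖ ^ 2 := by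
  by_contra hlt
  push Not at hlt
  obtain ⟨v, R, hbad, hR, hRG, hdiv⟩ :=
    _root_.Summit.AnomalousDissipation.AnomalousDissipation.Theorems.SteadyStatesLoudBounded.DodgerAssembly.stub_dodgerAssembly
      f E u hf hV hlt
      (_root_.Summit.AnomalousDissipation.AnomalousDissipation.Theorems.SteadyStatesLoudBounded.TruncationResidual.stub_truncationResidual
        f u hf hV hsol)
  obtain ⟨B, hB⟩ := hD v R hbad hR hRG
  obtain ⟨N, hN⟩ := hdiv B
  obtain ⟨n, hn, hle⟩ := hB N
  exact absurd hle (not_le.mpr (hN n hn))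

/-- Monotonicity of the dodger exclusion in the level. -/
theorem noOnsagerDodger_mono {f : Vec3} {E E' : ℝ} (hEE' : E ≤ E') (h : NoOnsagerDodger f E') : NoOnsagerDodger f E :=
  fun u R hseq hR hRD =>
    h u R (fun n => ⟨(hseq n).1, (hseq n).2.1, (hseq n).2.2.1, (hseq n).2.2.2.1.trans hEE', (hseq n).2.2.2.2⟩) hR hRD

/-- S1′ folded: no dodger of `f₁₂₃` at every level `≤ 3`. -/
theorem f123_noOnsagerDodger (hS1 : StubF123NoOnsagerDodgerLevel3) {E : ℝ} (hE : E ≤ 3) : NoOnsagerDodger f₁₂₃ E :=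
  noOnsagerDodger_mono hE fun u R h hR hRD => hS1 u R h hR hRD

/-- **FLOOR IN THE BALL at `f₁₂₃`, level `2`, from S1′ alone (PROVED over the landed L2–L4).** -/
theorem f123_floorInBall (hS1 : StubF123NoOnsagerDodgerLevel3) :
    ∃ ε₀ : ℝ, 0 < ε₀ ∧ SteadyFloorInBallAt f₁₂₃ 2 ε₀ 1 := by
  have hfs : Torus.IsSmooth f₁₂₃ := f123_smooth_divFree_zeroMean.1
  have hQ : NoQuietEulerPointV f₁₂₃ 2 := fun u hV hsol => by
    have h := le_energy_of_quietPoint (E := (2 : ℝ) + 1) hfs (f123_noOnsagerDodger hS1 (by norm_num)) u hV hsol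
    linarith
  obtain ⟨c, δ₀, hc, hδ₀, hrig⟩ := rigidAt_of_noEnemies hfs hQ (f123_noOnsagerDodger hS1 (by norm_num))
  refine ⟨min c (δ₀ ^ 2), lt_min hc (pow_pos hδ₀ 2), fun ν hν hν1 u hus hud huz hst hE => ?_⟩
  have hfloor : min c (δ₀ ^ 2 / ν) ≤ ν * Torus.gradNormSq u := residualTransfer hν hδ₀ hfs hrig hus hud huz hst hE
  have hdiv : δ₀ ^ 2 ≤ δ₀ ^ 2 / ν := by
    rw [le_div_iff₀ hν]
    nlinarith [sq_nonneg δ₀]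
  exact (min_le_min le_rfl hdiv).trans hfloor

/-- **THE RESTATED LINE (PROVED modulo its two stubs): S1′ verbatim + `BoundedSteadyBranchAt f₁₂₃ 2 ν₂` ⟹ the
repaired deciding hypothesis.** -/
theorem repairV3_of_f123_stubs (hS1 : StubF123NoOnsagerDodgerLevel3) {ν₂ : ℝ} (hν₂ : 0 < ν₂)
    (hB : BoundedSteadyBranchAt f₁₂₃ 2 ν₂) : SteadyFloorInBallBoundedSome := by
  obtain ⟨ε₀, hε₀, hF⟩ := f123_floorInBall hS1
  exact repair_of_pinned f123_smooth_divFree_zeroMean hε₀ one_pos hν₂ hF hB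

/-- **… and hence the SUMMIT (PROVED modulo the same two stubs).** -/
theorem anomalousDissipation_of_f123_stubs (hS1 : StubF123NoOnsagerDodgerLevel3) {ν₂ : ℝ} (hν₂ : 0 < ν₂)
    (hB : BoundedSteadyBranchAt f₁₂₃ 2 ν₂) : _root_.AnomalousDissipation :=
  anomalousDissipation_of_floorInBall_boundedSome (repairV3_of_f123_stubs hS1 hν₂ hB)

/-- For the record: the crux as stated would follow from the SAME floor stub plus the (numerically dead) steady
ceiling at level 2 — the live skeleton's composition, restated through §D (PROVED). -/
theorem crux_of_f123_stub_and_ceiling (hS1 : StubF123NoOnsagerDodgerLevel3) {ν₁ : ℝ} (hν₁ : 0 < ν₁)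
    (hC : SteadyCeilingAt f₁₂₃ 2 ν₁) : SteadyStatesLoudBounded := by
  obtain ⟨ε₀, hε₀, hF⟩ := f123_floorInBall hS1
  exact crux_of_ceiling_floorInBall f123_smooth_divFree_zeroMean hε₀ one_pos hν₁ hC hF

end Summit.AnomalousDissipation.AnomalousDissipation.Cruxes.SteadyStatesLoudBounded.StrategyCensusV3

end
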